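import Summits.CriticalPhenomena.PercolationContinuityZ3.Theorems.PercNearOneGluingNoHeavyLowerTailThreePointIsoSexticSureComponent
import Summits.CriticalPhenomena.PercolationContinuityZ3.Theorems.PercNearOneGluingNoHeavyConstsThreePointCovariance
import Literature.Probability.Percolation.ConditionalPositiveAssociationProofs
import Literature.Probability.Percolation.TwoClusterConditionalAssociation
import Literature.Probability.Percolation.KozmaNitzanSeparatingTriple
import Literature.Probability.Percolation.ShorteningInfluenceBound
import Literature.Probability.Percolation.MooreShannonInfluenceBoundGeneral
import Literature.Probability.Percolation.KozmaNitzanPreFKG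
import HarnessLib

/-!
# An upper bound for the Harris covariance `Cov(1_{a↔c}, 1_{b↔c})` by the closed boundary between the clusters of `c` and of `{a,b}`

Support file for crux `stmt-CriticalPhenomena-4575` (`NoHeavyLowerTail`), seat `prim-l12-p1` gen 23 (`--supports`); memo
`run/shared/lean/prim/prim-l12/FROM-prim-l12-p1-g23-COV-BOUNDARY.md`.  Bond percolation `μ = prodBernoulli w`, arbitrary pair weights `w : Sym2 V → [0,1]`
on a finite vertex type, any vertices `a, b, c`.  ATTRIBUTION: the inequality is prim-ineq-prove-2's THEOREM A ("contact-mass bound", MEMO-14 §2, 2026-08-20;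
kernel in the equivalent BRIDGE form `GZBridge.cov_le_integral_bridgeSum`); this file gives the CONTACT form with an independent proof (port induction +
van den Berg–Häggström–Kahn Thm 1.3 instead of the martingale identity / Gladkov's Thm 8.2).  THEOREM (`cov_conn_le_boundary`) — an UPPER bound matching Harris' `Cov ≥ 0`:
  `μ(a↔c, b↔c) − μ(a↔c)·μ(b↔c) ≤ ∑_e w(e) · μ(a↔b, a↮c, b↮c, e joins the cluster of c to the cluster of a)`,
the expected total weight, on `ab|c`, of the (closed) pairs between the open clusters of `c` and of `{a,b}`; equality for stars `c – h – {a,b}`.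
Proof: induction on the number of pairs with weight in `(0,1)`; forcing a pair `e = cx` AT THE PORT to `0`/`1` changes the two sides by
`p(1−p)·μ₀(x↔a, x↮c)·μ₀(x↔b, x↮c)` resp. `p(1−p)·μ₀(x↔a, x↔b, x↮c)` (`μ₀`: `e` closed), compared by van den Berg–Häggström–Kahn 2006 Thm. 1.3
(tree: `BHK2006_clusterConditionalPositiveAssociation_holds`); weight-one pairs via the sure-component transfer of `…ThreePointIsoSexticSureComponent`.
COROLLARY (`threePointGap_le_boundary`): the gap `μ(a|b|c)μ(abc) − μ(ac|b)μ(bc|a)` of Gladkov's Conjecture 10.1 (`Consts.ThreePointGapContinuity`)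
equals `Cov − μ(abc)μ(ab|c)` (`Consts.SK3.sk_sub_eq_cov`), hence is at most the same boundary sum `≤ μ(ab|c) · (largest closed c-boundary weight)`:
the conjecture holds uniformly on every class of weighted graphs with bounded boundary weights and is reduced in general to a large-deviation
estimate for that weight (memo §3).  No definitions, no sorries, standard axioms.
-/

namespace Summit.CriticalPhenomena.PercolationContinuityZ3.Theorems.ThreePointCovBoundary

open MeasureTheory Set Filter
open Literature.Probability.Percolation Literature.Probability.LatticeModels
open ThreePointIsoSexticSureComponent
open scoped Classical

variable {V : Type*} [Fintype V]

/-- **van den Berg–Häggström–Kahn, Thm. 1.3, for two connection indicators**: given `x ↮ c`, the events `x ↔ a` and `x ↔ b` (increasing in the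
cluster of `x`) are positively correlated; in denominator-free form and after dropping the factor `μ(x ↮ c) ≤ 1`:
`μ(x↔a, x↮c) · μ(x↔b, x↮c) ≤ μ(x↔a, x↔b, x↮c)`. [cite: VandenbergHaggstromKahn2005, Thm. 1.3 (p. 6)] -/
theorem conn_conn_notConn_ge (w : Sym2 V → unitInterval) {x c : V} (a b : V) (hxc : x ≠ c) :
    (prodBernoulli w).real (openConn x a ∩ (openConn x c)ᶜ) * (prodBernoulli w).real (openConn x b ∩ (openConn x c)ᶜ) ≤
      (prodBernoulli w).real (openConn x a ∩ openConn x b ∩ (openConn x c)ᶜ) := by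
  set μ := prodBernoulli w with hμ
  have key := BHK2006_clusterConditionalPositiveAssociation_holds V w x {c} (connIndicatorFn x a) (connIndicatorFn x b)
    (monotone_connIndicatorFn x a) (monotone_connIndicatorFn x b) (by simpa using hxc)
  have hD : {ω : BondConfig V | ∀ y ∈ ({c} : Set V), ¬ (openGraph ω).Reachable x y} = (openConn x c)ᶜ := by
    ext ω; simp [openConn]
  have hma : MeasurableSet (openConn x a : Set (BondConfig V)) := measurableSet_openConn_holds x a
  have hmb : MeasurableSet (openConn x b : Set (BondConfig V)) := measurableSet_openConn_holds x b
  simp only [connIndicatorFn_openEdgeCluster, hD] at key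
  rw [show (fun ω : BondConfig V => (openConn x a).indicator (1 : BondConfig V → ℝ) ω *
        (openConn x b).indicator 1 ω) = (openConn x a ∩ openConn x b).indicator 1 from
      funext fun ω => (congrFun (Set.inter_indicator_one (s := openConn x a)
        (t := openConn x b) (M₀ := ℝ)) ω).symm] at key
  rw [setIntegral_indicator (hma.inter hmb), setIntegral_indicator hma, setIntegral_indicator hmb] at key
  simp only [Pi.one_apply, setIntegral_const, smul_eq_mul, mul_one] at key
  -- `key : μ(Dᶜ∩A) μ(Dᶜ∩B) ≤ μ(Dᶜ) μ(Dᶜ ∩ (A∩B))`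
  have h1 : μ.real (openConn x c)ᶜ ≤ 1 := measureReal_le_one
  have hnn : 0 ≤ μ.real ((openConn x c)ᶜ ∩ (openConn x a ∩ openConn x b)) := measureReal_nonneg
  rw [inter_comm (openConn x a), inter_comm (openConn x b), show (openConn x a ∩ openConn x b ∩ (openConn x c)ᶜ : Set (BondConfig V)) =
    (openConn x c)ᶜ ∩ (openConn x a ∩ openConn x b) from inter_comm _ _]
  calc μ.real ((openConn x c)ᶜ ∩ openConn x a) * μ.real ((openConn x c)ᶜ ∩ openConn x b)
      ≤ μ.real (openConn x c)ᶜ * μ.real ((openConn x c)ᶜ ∩ (openConn x a ∩ openConn x b)) := key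
    _ ≤ 1 * μ.real ((openConn x c)ᶜ ∩ (openConn x a ∩ openConn x b)) := mul_le_mul_of_nonneg_right h1 hnn
    _ = _ := one_mul _

omit [Fintype V] in
/-- Opening `cx`: `a ↔ c` becomes `a ↔ c ∨ a ↔ x`. [folklore] -/
theorem setOf_insert_mem_conn (a c x : V) :
    {ω : BondConfig V | insert s(c, x) ω ∈ (openConn a c : Set (BondConfig V))} = openConn a c ∪ openConn a x := by
  ext ω
  have h := KNSep.reachable_insert_iff ω c x a c
  simp only [mem_setOf_eq, openConn, mem_union, h]
  constructor
  · rintro (h1 | ⟨h1, -⟩ | ⟨h1, -⟩)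
    · exact Or.inl h1
    · exact Or.inl h1
    · exact Or.inr h1
  · rintro (h1 | h1)
    · exact Or.inl h1
    · exact Or.inr (Or.inr ⟨h1, SimpleGraph.Reachable.refl c⟩)

omit [Fintype V] in
/-- Opening `cx`: `a ↔ c ∧ b ↔ c` becomes `(a ↔ c ∨ a ↔ x) ∧ (b ↔ c ∨ b ↔ x)`. [folklore] -/
theorem setOf_insert_mem_conn_inter (a b c x : V) :
    {ω : BondConfig V | insert s(c, x) ω ∈ (openConn a c ∩ openConn b c : Set (BondConfig V))} =
      (openConn a c ∪ openConn a x) ∩ (openConn b c ∪ openConn b x) := by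
  rw [← setOf_insert_mem_conn a c x, ← setOf_insert_mem_conn b c x]
  ext ω; simp

omit [Fintype V] in
/-- `(a↔c ∨ a↔x) ∖ (a↔c) = (x↔a) ∩ (x↮c)`. [folklore] -/
theorem conn_union_diff_eq (a c x : V) :
    ((openConn a c ∪ openConn a x) \ openConn a c : Set (BondConfig V)) = openConn x a ∩ (openConn x c)ᶜ := by
  ext ω
  simp only [Set.mem_sdiff, mem_union, mem_inter_iff, mem_compl_iff, openConn, mem_setOf_eq]
  constructor
  · rintro ⟨h1 | h1, h2⟩
    · exact (h2 h1).elim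
    · exact ⟨h1.symm, fun h => h2 (h1.trans h)⟩
  · rintro ⟨h1, h2⟩
    exact ⟨Or.inr h1.symm, fun h => h2 (h1.trans h)⟩

omit [Fintype V] in
/-- The event "`ab|c` and the pair `e` joins the cluster of `c` to the cluster of `a`", for the pair `e = cx` at the port itself, is
`x↔a ∩ x↔b ∩ x↮c`. [this work] -/
theorem sepJoin_self_eq (a b c x : V) :
    (openConn a b ∩ (openConn a c)ᶜ ∩ (openConn b c)ᶜ ∩
        {ω : BondConfig V | ∃ y z : V, s(c, x) = s(y, z) ∧ (openGraph ω).Reachable c y ∧ (openGraph ω).Reachable a z} : Set (BondConfig V)) =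
      openConn x a ∩ openConn x b ∩ (openConn x c)ᶜ := by
  ext ω
  simp only [mem_inter_iff, mem_compl_iff, openConn, mem_setOf_eq]
  constructor
  · rintro ⟨⟨⟨hab, hac⟩, hbc⟩, y, z, hyz, hcy, haz⟩
    rcases Sym2.eq_iff.1 hyz with ⟨rfl, rfl⟩ | ⟨rfl, rfl⟩
    · exact ⟨⟨haz.symm, haz.symm.trans hab⟩, fun h => hac (haz.trans h)⟩
    · exact (hac haz).elim
  · rintro ⟨⟨hxa, hxb⟩, hxc⟩
    refine ⟨⟨⟨hxa.symm.trans hxb, fun h => hxc (hxa.trans h)⟩, fun h => hxc (hxb.trans h)⟩,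
      c, x, rfl, SimpleGraph.Reachable.refl c, hxa.symm⟩

omit [Fintype V] in
/-- Opening the pair `e = cx` kills the event "`ab|c` and `e` joins `C(c)` to `C(a)`": once `e` is open, a join through `e` puts `a` in `C(c)`.
[this work] -/
theorem setOf_insert_mem_sepJoin_self (a b c x : V) :
    {ω : BondConfig V | insert s(c, x) ω ∈ (openConn a b ∩ (openConn a c)ᶜ ∩ (openConn b c)ᶜ ∩
        {ω : BondConfig V | ∃ y z : V, s(c, x) = s(y, z) ∧ (openGraph ω).Reachable c y ∧ (openGraph ω).Reachable a z} : Set (BondConfig V))} =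
      ∅ := by
  ext ω
  simp only [mem_setOf_eq, mem_inter_iff, mem_compl_iff, openConn, mem_empty_iff_false, iff_false]
  rintro ⟨⟨⟨-, hac⟩, -⟩, y, z, hyz, -, haz⟩
  rcases Sym2.eq_iff.1 hyz with ⟨rfl, rfl⟩ | ⟨rfl, rfl⟩
  · -- `a ↔ x` in `insert s(c,x) ω`, and `x ↔ c` there
    have hxc : (openGraph (insert s(c, x) ω)).Reachable x c := by
      rw [KNSep.reachable_insert_iff]
      exact Or.inr (Or.inr ⟨SimpleGraph.Reachable.refl x, SimpleGraph.Reachable.refl c⟩)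
    exact hac (haz.trans hxc)
  · exact hac haz

section Step

variable [DecidableEq V]

/-- **One-bond step.**  For `e = cx` with `x ≠ c`: if the covariance bound holds for the weights `w[e ↦ 0]` and `w[e ↦ 1]`, it holds for `w`.
The two sides are affine-plus-`p(1−p)`·(correction) in `p = w(e)`; the correction of the covariance is `μ₀(x↔a, x↮c)·μ₀(x↔b, x↮c)`, that of
the boundary sum is `μ₀(x↔a, x↔b, x↮c)`, and BHK Thm. 1.3 compares them (`conn_conn_notConn_ge`). [this work] -/
theorem cov_le_boundary_oneBond (w : Sym2 V → unitInterval) (a b c x : V) (hxc : x ≠ c)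
    (h0 : (prodBernoulli (Function.update w s(c, x) 0)).real (openConn a c ∩ openConn b c) -
        (prodBernoulli (Function.update w s(c, x) 0)).real (openConn a c) * (prodBernoulli (Function.update w s(c, x) 0)).real (openConn b c) ≤
      ∑ e : Sym2 V, (Function.update w s(c, x) 0 e : ℝ) * (prodBernoulli (Function.update w s(c, x) 0)).real
        (openConn a b ∩ (openConn a c)ᶜ ∩ (openConn b c)ᶜ ∩
          {ω | ∃ y z : V, e = s(y, z) ∧ (openGraph ω).Reachable c y ∧ (openGraph ω).Reachable a z}))
    (h1 : (prodBernoulli (Function.update w s(c, x) 1)).real (openConn a c ∩ openConn b c) -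
        (prodBernoulli (Function.update w s(c, x) 1)).real (openConn a c) * (prodBernoulli (Function.update w s(c, x) 1)).real (openConn b c) ≤
      ∑ e : Sym2 V, (Function.update w s(c, x) 1 e : ℝ) * (prodBernoulli (Function.update w s(c, x) 1)).real
        (openConn a b ∩ (openConn a c)ᶜ ∩ (openConn b c)ᶜ ∩
          {ω | ∃ y z : V, e = s(y, z) ∧ (openGraph ω).Reachable c y ∧ (openGraph ω).Reachable a z})) :
    (prodBernoulli w).real (openConn a c ∩ openConn b c) -
        (prodBernoulli w).real (openConn a c) * (prodBernoulli w).real (openConn b c) ≤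
      ∑ e : Sym2 V, (w e : ℝ) * (prodBernoulli w).real
        (openConn a b ∩ (openConn a c)ᶜ ∩ (openConn b c)ᶜ ∩
          {ω | ∃ y z : V, e = s(y, z) ∧ (openGraph ω).Reachable c y ∧ (openGraph ω).Reachable a z}) := by
  set e : Sym2 V := s(c, x) with he
  set μ := prodBernoulli w with hμ
  set μ0 := prodBernoulli (Function.update w e 0) with hμ0
  set μ1 := prodBernoulli (Function.update w e 1) with hμ1
  set X : Sym2 V → Set (BondConfig V) := fun f => openConn a b ∩ (openConn a c)ᶜ ∩ (openConn b c)ᶜ ∩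
    {ω | ∃ y z : V, f = s(y, z) ∧ (openGraph ω).Reachable c y ∧ (openGraph ω).Reachable a z} with hX
  set p : ℝ := (w e : ℝ) with hp
  have hp0 : 0 ≤ p := (w e).2.1
  have hp1 : p ≤ 1 := (w e).2.2
  -- one-bond decomposition and the `e`-open endpoint
  have hob : ∀ A : Set (BondConfig V), μ.real A = (1 - p) * μ0.real A + p * μ1.real A := fun A =>
    prodBernoulli_real_oneBond (determinedBy_coe_univ A) w (Finset.mem_univ e)
  have hupd : ∀ A : Set (BondConfig V), μ1.real A = μ0.real {ω | insert e ω ∈ A} := fun A => by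
    rw [hμ1, hμ0, ← prodBernoulli_real_update_one_eq (determinedBy_coe_univ A) (Function.update w e 0) (Finset.mem_univ e),
      Function.update_idem]
  -- the covariance increments
  have dA : μ1.real (openConn a c) - μ0.real (openConn a c) = μ0.real (openConn x a ∩ (openConn x c)ᶜ) := by
    rw [hupd, setOf_insert_mem_conn, ← conn_union_diff_eq a c x]
    have h := measureReal_inter_add_sdiff (μ := μ0) (s := openConn a c ∪ openConn a x) (t := openConn a c) MeasurableSet.of_discrete
    rw [union_inter_cancel_left] at h
    linarith
  have dB : μ1.real (openConn b c) - μ0.real (openConn b c) = μ0.real (openConn x b ∩ (openConn x c)ᶜ) := by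
    rw [hupd, setOf_insert_mem_conn, ← conn_union_diff_eq b c x]
    have h := measureReal_inter_add_sdiff (μ := μ0) (s := openConn b c ∪ openConn b x) (t := openConn b c) MeasurableSet.of_discrete
    rw [union_inter_cancel_left] at h
    linarith
  -- the boundary term at `e` itself
  have hXe1 : μ1.real (X e) = 0 := by
    rw [hupd, hX]
    simp only
    rw [he, setOf_insert_mem_sepJoin_self, measureReal_empty]
  have hXe0 : μ0.real (X e) = μ0.real (openConn x a ∩ openConn x b ∩ (openConn x c)ᶜ) := by
    rw [hX]
    simp only
    rw [he, sepJoin_self_eq]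
  -- BHK
  have hBHK := conn_conn_notConn_ge (Function.update w e 0) a b hxc
  rw [← hμ0, ← hXe0, ← dA, ← dB] at hBHK
  -- splitting the three boundary sums at `e`
  have split : ∀ g : Sym2 V → ℝ, ∑ f, g f = g e + ∑ f ∈ Finset.univ.erase e, g f := fun g =>
    (Finset.add_sum_erase _ _ (Finset.mem_univ e)).symm
  set R0 : ℝ := ∑ f ∈ Finset.univ.erase e, (w f : ℝ) * μ0.real (X f) with hR0
  set R1 : ℝ := ∑ f ∈ Finset.univ.erase e, (w f : ℝ) * μ1.real (X f) with hR1
  have hTw : ∑ f, (w f : ℝ) * μ.real (X f) = p * ((1 - p) * μ0.real (X e)) + ((1 - p) * R0 + p * R1) := by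
    rw [split, hob (X e), hXe1, mul_zero, add_zero, hR0, hR1, Finset.mul_sum, Finset.mul_sum, ← Finset.sum_add_distrib]
    congr 1
    refine Finset.sum_congr rfl fun f _ => ?_
    rw [hob (X f)]; ring
  have hT1 : ∑ f, (Function.update w e 1 f : ℝ) * μ1.real (X f) = R1 := by
    rw [split, hXe1, mul_zero, zero_add, hR1]
    refine Finset.sum_congr rfl fun f hf => ?_
    rw [Function.update_of_ne (Finset.ne_of_mem_erase hf)]
  have hT0 : ∑ f, (Function.update w e 0 f : ℝ) * μ0.real (X f) = R0 := by
    rw [split, Function.update_self, hR0]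
    simp only [Set.Icc.coe_zero, zero_mul, zero_add]
    refine Finset.sum_congr rfl fun f hf => ?_
    rw [Function.update_of_ne (Finset.ne_of_mem_erase hf)]
  change μ1.real (openConn a c ∩ openConn b c) - μ1.real (openConn a c) * μ1.real (openConn b c) ≤
    ∑ f, (Function.update w e 1 f : ℝ) * μ1.real (X f) at h1
  change μ0.real (openConn a c ∩ openConn b c) - μ0.real (openConn a c) * μ0.real (openConn b c) ≤
    ∑ f, (Function.update w e 0 f : ℝ) * μ0.real (X f) at h0
  change μ.real (openConn a c ∩ openConn b c) - μ.real (openConn a c) * μ.real (openConn b c) ≤ ∑ f, (w f : ℝ) * μ.real (X f)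
  rw [hT1] at h1
  rw [hT0] at h0
  rw [hTw, hob (openConn a c ∩ openConn b c), hob (openConn a c), hob (openConn b c)]
  have i1 := mul_le_mul_of_nonneg_left h1 hp0
  have i0 := mul_le_mul_of_nonneg_left h0 (by linarith : 0 ≤ 1 - p)
  have i2 := mul_le_mul_of_nonneg_left hBHK (mul_nonneg hp0 (by linarith : 0 ≤ 1 - p))
  nlinarith [i0, i1, i2]

end Step

/-- **Transfer of the port along an almost sure connection**: if `μ(c ↔ u) = 1`, both sides of the covariance bound are the same for the ports
`c` and `u`. [this work] -/
theorem transfer_cov_boundary (w : Sym2 V → unitInterval) {a b c u : V} (h1 : (prodBernoulli w).real (openConn c u) = 1) :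
    (prodBernoulli w).real (openConn a c ∩ openConn b c) = (prodBernoulli w).real (openConn a u ∩ openConn b u) ∧
    (prodBernoulli w).real (openConn a c) = (prodBernoulli w).real (openConn a u) ∧
    (prodBernoulli w).real (openConn b c) = (prodBernoulli w).real (openConn b u) ∧
    ∀ e : Sym2 V, (prodBernoulli w).real (openConn a b ∩ (openConn a c)ᶜ ∩ (openConn b c)ᶜ ∩
          {ω | ∃ y z : V, e = s(y, z) ∧ (openGraph ω).Reachable c y ∧ (openGraph ω).Reachable a z}) =
      (prodBernoulli w).real (openConn a b ∩ (openConn a u)ᶜ ∩ (openConn b u)ᶜ ∩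
          {ω | ∃ y z : V, e = s(y, z) ∧ (openGraph ω).Reachable u y ∧ (openGraph ω).Reachable a z}) := by
  set μ := prodBernoulli w with hμ
  have h1' : μ (openConn c u : Set (BondConfig V)) = 1 := by
    rw [measureReal_def] at h1
    exact (ENNReal.toReal_eq_one_iff _).1 h1
  have hae : ∀ᵐ ω ∂μ, ω ∈ (openConn c u : Set (BondConfig V)) := (mem_ae_iff_prob_eq_one MeasurableSet.of_discrete).2 h1'
  have hp : ∀ p : V, ((openConn p c : Set (BondConfig V)) : Set (BondConfig V)) =ᵐ[μ] (openConn p u : Set (BondConfig V)) := by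
    intro p
    rw [eventuallyEq_set]; filter_upwards [hae] with ω hω
    simp only [openConn, mem_setOf_eq] at hω ⊢; exact ⟨fun h => h.trans hω, fun h => h.trans hω.symm⟩
  have hJ : ∀ e : Sym2 V, ({ω | ∃ y z : V, e = s(y, z) ∧ (openGraph ω).Reachable c y ∧ (openGraph ω).Reachable a z} : Set (BondConfig V))
      =ᵐ[μ] ({ω | ∃ y z : V, e = s(y, z) ∧ (openGraph ω).Reachable u y ∧ (openGraph ω).Reachable a z} : Set (BondConfig V)) := by
    intro e
    rw [eventuallyEq_set]
    filter_upwards [hae] with ω hω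
    simp only [openConn, mem_setOf_eq] at hω ⊢
    constructor
    · rintro ⟨y, z, hyz, hcy, haz⟩; exact ⟨y, z, hyz, hω.symm.trans hcy, haz⟩
    · rintro ⟨y, z, hyz, huy, haz⟩; exact ⟨y, z, hyz, hω.trans huy, haz⟩
  refine ⟨measureReal_congr ((hp a).inter (hp b)), measureReal_congr (hp a), measureReal_congr (hp b), fun e => measureReal_congr ?_⟩
  exact ((EventuallyEq.rfl.inter (hp a).compl).inter (hp b).compl).inter (hJ e)

/-- The boundary sum is nonnegative. [this work] -/
theorem boundary_nonneg (w : Sym2 V → unitInterval) (a b c : V) :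
    0 ≤ ∑ e : Sym2 V, (w e : ℝ) * (prodBernoulli w).real
        (openConn a b ∩ (openConn a c)ᶜ ∩ (openConn b c)ᶜ ∩
          {ω | ∃ y z : V, e = s(y, z) ∧ (openGraph ω).Reachable c y ∧ (openGraph ω).Reachable a z}) :=
  Finset.sum_nonneg fun e _ => mul_nonneg (w e).2.1 measureReal_nonneg

/-- The covariance of two events vanishes when the first has probability `1`. [folklore] -/
theorem cov_eq_zero_of_real_eq_one {μ : Measure (BondConfig V)} [IsProbabilityMeasure μ] {A B : Set (BondConfig V)} (hA : μ.real A = 1) :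
    μ.real (A ∩ B) - μ.real A * μ.real B = 0 := by
  have hA' : μ A = 1 := by rw [measureReal_def] at hA; exact (ENNReal.toReal_eq_one_iff _).1 hA
  have hae : (A : Set (BondConfig V)) =ᵐ[μ] (univ : Set (BondConfig V)) := by
    rw [eventuallyEq_set]
    filter_upwards [(mem_ae_iff_prob_eq_one MeasurableSet.of_discrete).2 hA'] with ω hω
    simp [hω]
  rw [measureReal_congr (hae.inter EventuallyEq.rfl), univ_inter, hA, one_mul, sub_self]

omit [Fintype V] in
/-- The covariance of two events vanishes when the first has probability `0`. [folklore] -/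
theorem cov_eq_zero_of_real_eq_zero {μ : Measure (BondConfig V)} [IsFiniteMeasure μ] {A B : Set (BondConfig V)} (hA : μ.real A = 0) :
    μ.real (A ∩ B) - μ.real A * μ.real B = 0 := by
  have h : μ.real (A ∩ B) = 0 := le_antisymm (le_trans (measureReal_mono inter_subset_left) hA.le) measureReal_nonneg
  rw [h, hA, zero_mul, sub_self]

/-- **The closed case.**  If `a` is not surely joined to `c` and no pair leaving the sure component of `c` has weight in `(0,1)`, then almost
surely the cluster of `c` is its sure component, so `μ(a ↔ c) = 0`. [this work] -/
theorem real_conn_eq_zero_of_closedSure (w : Sym2 V → unitInterval) {a c : V}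
    (hKa : ¬ (openGraph {e : Sym2 V | (w e : ℝ) = 1}).Reachable c a)
    (hB : ¬ ∃ u x : V, (openGraph {e : Sym2 V | (w e : ℝ) = 1}).Reachable c u ∧ ¬ (openGraph {e : Sym2 V | (w e : ℝ) = 1}).Reachable c x ∧
      (0 : ℝ) < w s(u, x) ∧ (w s(u, x) : ℝ) < 1) :
    (prodBernoulli w).real (openConn a c) = 0 := by
  set μ := prodBernoulli w with hμ
  set G1 : SimpleGraph V := openGraph {e : Sym2 V | (w e : ℝ) = 1} with hG1
  have hzero : ∀ u x : V, G1.Reachable c u → ¬ G1.Reachable c x → (w s(u, x) : ℝ) = 0 := by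
    intro u x hu hx
    rcases (w s(u, x)).2.1.eq_or_lt with h | hpos
    · exact h.symm
    rcases (w s(u, x)).2.2.eq_or_lt' with h | hlt
    · have hadj : G1.Adj u x := by rw [hG1, openGraph_adj]; exact ⟨h.symm, fun hux => hx (hux ▸ hu)⟩
      exact (hx (hu.trans hadj.reachable)).elim
    · exact (hB ⟨u, x, hu, hx, hpos, hlt⟩).elim
  have hclosed : ∀ᵐ ω ∂μ, ∀ u x : V, G1.Reachable c u → ¬ G1.Reachable c x → s(u, x) ∉ ω := by
    have : ∀ᵐ ω ∂μ, ∀ q : V × V, G1.Reachable c q.1 → ¬ G1.Reachable c q.2 → s(q.1, q.2) ∉ ω := by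
      rw [ae_all_iff]
      rintro ⟨u, x⟩
      by_cases hux : G1.Reachable c u ∧ ¬ G1.Reachable c x
      · have h0 : μ.real {ω | s(u, x) ∈ ω} = 0 := by rw [hμ, prodBernoulli_real_setOf_mem, hzero u x hux.1 hux.2]
        have h0' : μ {ω | s(u, x) ∈ ω} = 0 := (measureReal_eq_zero_iff (by finiteness)).1 h0
        filter_upwards [measure_eq_zero_iff_ae_notMem.1 h0'] with ω hω
        intro _ _; simpa using hω
      · exact Eventually.of_forall fun ω h h' => (hux ⟨h, h'⟩).elim
    filter_upwards [this] with ω hω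
    exact fun u x hu hx => hω (u, x) hu hx
  have hcluster : ∀ᵐ ω ∂μ, ∀ v : V, (openGraph ω).Reachable c v → G1.Reachable c v := by
    filter_upwards [hclosed] with ω hω
    intro v hv; by_contra hKv; obtain ⟨q⟩ := hv
    obtain ⟨d, -, hd1, hd2⟩ := q.exists_boundary_dart {y | G1.Reachable c y} (SimpleGraph.Reachable.refl c) hKv
    have hadj := d.adj; rw [openGraph_adj] at hadj; exact hω _ _ hd1 hd2 hadj.1
  have hac : (openConn a c : Set (BondConfig V)) =ᵐ[μ] (∅ : Set (BondConfig V)) := by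
    rw [eventuallyEq_set]
    filter_upwards [hcluster] with ω hω
    simp only [openConn, mem_setOf_eq, mem_empty_iff_false, iff_false]
    exact fun h => hKa (hω a h.symm)
  rw [measureReal_congr hac, measureReal_empty]

/-- **Upper bound for the Harris covariance by the closed boundary (all finite weighted graphs).**  For bond percolation with arbitrary
pair weights on a finite vertex type and any vertices `a, b, c`:
`μ(a↔c ∧ b↔c) − μ(a↔c)·μ(b↔c) ≤ ∑_e w(e) · μ(a↔b ∧ a↮c ∧ b↮c ∧ e joins the cluster of c to the cluster of a)`.
Equality for the star `c – h – {a, b}`.  [this work; BHK 2006 Thm. 1.3 is the only correlation input] -/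
theorem cov_conn_le_boundary (w : Sym2 V → unitInterval) (a b c : V) :
    (prodBernoulli w).real (openConn a c ∩ openConn b c) -
        (prodBernoulli w).real (openConn a c) * (prodBernoulli w).real (openConn b c) ≤
      ∑ e : Sym2 V, (w e : ℝ) * (prodBernoulli w).real
        (openConn a b ∩ (openConn a c)ᶜ ∩ (openConn b c)ᶜ ∩
          {ω | ∃ y z : V, e = s(y, z) ∧ (openGraph ω).Reachable c y ∧ (openGraph ω).Reachable a z}) := by
  suffices H : ∀ (n : ℕ) (w : Sym2 V → unitInterval) (c : V),
      (Finset.univ.filter fun f : Sym2 V => (0 : ℝ) < w f ∧ (w f : ℝ) < 1).card = n →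
      (prodBernoulli w).real (openConn a c ∩ openConn b c) -
          (prodBernoulli w).real (openConn a c) * (prodBernoulli w).real (openConn b c) ≤
        ∑ e : Sym2 V, (w e : ℝ) * (prodBernoulli w).real
          (openConn a b ∩ (openConn a c)ᶜ ∩ (openConn b c)ᶜ ∩
            {ω | ∃ y z : V, e = s(y, z) ∧ (openGraph ω).Reachable c y ∧ (openGraph ω).Reachable a z}) from H _ w c rfl
  intro n
  induction n using Nat.strong_induction_on with
  | _ n ih =>
  intro w c hn
  -- `a` surely joined to `c`: the covariance vanishes
  by_cases hKa : (openGraph {e : Sym2 V | (w e : ℝ) = 1}).Reachable c a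
  · have h1 : (prodBernoulli w).real (openConn a c) = 1 := by
      rw [KNPreFKG.openConn_symm]; exact real_openConn_eq_one_of_sure w hKa
    rw [cov_eq_zero_of_real_eq_one h1]
    exact boundary_nonneg w a b c
  by_cases hKb : (openGraph {e : Sym2 V | (w e : ℝ) = 1}).Reachable c b
  · have h1 : (prodBernoulli w).real (openConn b c) = 1 := by
      rw [KNPreFKG.openConn_symm]; exact real_openConn_eq_one_of_sure w hKb
    rw [inter_comm, mul_comm, cov_eq_zero_of_real_eq_one h1]
    exact boundary_nonneg w a b c
  -- a fractional pair leaving the sure component: one-bond step at the port `u`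
  by_cases hA : ∃ u x : V, (openGraph {e : Sym2 V | (w e : ℝ) = 1}).Reachable c u ∧
      ¬ (openGraph {e : Sym2 V | (w e : ℝ) = 1}).Reachable c x ∧ (0 : ℝ) < w s(u, x) ∧ (w s(u, x) : ℝ) < 1
  · obtain ⟨u, x, hu, hx, h0, h1⟩ := hA
    have hxu : x ≠ u := fun h => hx (h ▸ hu)
    obtain ⟨eAB, eA, eB, eJ⟩ := transfer_cov_boundary w (a := a) (b := b) (real_openConn_eq_one_of_sure w hu)
    rw [eAB, eA, eB, Finset.sum_congr rfl fun e _ => by rw [eJ e]]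
    refine cov_le_boundary_oneBond w a b u x hxu ?_ ?_
    · exact ih _ (hn ▸ card_fractional_update_lt w h0 h1 0 (Or.inl rfl)) _ u rfl
    · exact ih _ (hn ▸ card_fractional_update_lt w h0 h1 1 (Or.inr rfl)) _ u rfl
  -- no fractional pair leaves the sure component: `μ(a ↔ c) = 0`
  · rw [cov_eq_zero_of_real_eq_zero (real_conn_eq_zero_of_closedSure w hKa hA)]
    exact boundary_nonneg w a b c

/-- **The three-point gap is at most the boundary sum.**  In the cells of `Consts.ThreePointGapContinuity` (Gladkov 2024, Conj. 10.1):
`μ(a|b|c)·μ(abc) − μ(a alone)·μ(b alone) ≤ ∑_e w(e)·μ(ab|c ∩ {e joins C(c), C(a)})`, because the gap equals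
`Cov(1_{c↔a}, 1_{c↔b}) − μ(abc)·μ(ab|c)` (`Consts.SK3.sk_sub_eq_cov`).  In particular the gap is at most `μ(ab|c)` times the largest total weight
of a closed `c`-boundary, which settles the conjecture on every class of weighted graphs with uniformly bounded boundary weights.
[cite: Gladkov2024, Conjecture 10.1 (§10)] [this work] -/
theorem threePointGap_le_boundary (w : Sym2 V → unitInterval) (a b c : V) :
    (prodBernoulli w).real ((openConn a b)ᶜ ∩ (openConn a c)ᶜ ∩ (openConn b c)ᶜ) *
          (prodBernoulli w).real (openConn a b ∩ openConn a c ∩ openConn b c) -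
        (prodBernoulli w).real ((openConn a b)ᶜ ∩ (openConn a c)ᶜ ∩ openConn b c) *
          (prodBernoulli w).real ((openConn b a)ᶜ ∩ (openConn b c)ᶜ ∩ openConn a c) ≤
      ∑ e : Sym2 V, (w e : ℝ) * (prodBernoulli w).real
        (openConn a b ∩ (openConn a c)ᶜ ∩ (openConn b c)ᶜ ∩
          {ω | ∃ y z : V, e = s(y, z) ∧ (openGraph ω).Reachable c y ∧ (openGraph ω).Reachable a z}) := by
  have hcov := Consts.SK3.sk_sub_eq_cov (prodBernoulli w) a b c
  have hmain := cov_conn_le_boundary w a b c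
  rw [KNPreFKG.openConn_symm c a, KNPreFKG.openConn_symm c b] at hcov
  have hnn : 0 ≤ (prodBernoulli w).real (openConn a b ∩ openConn a c ∩ openConn b c) *
      (prodBernoulli w).real ((openConn a c)ᶜ ∩ (openConn b c)ᶜ ∩ openConn a b) := mul_nonneg measureReal_nonneg measureReal_nonneg
  linarith

end Summit.CriticalPhenomena.PercolationContinuityZ3.Theorems.ThreePointCovBoundary
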